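import Summits.HubbardSuperconductivity.HubbardSuperconductivity.Theorems.WidthHaldaneBochnerFloor
import Summits.HubbardSuperconductivity.HubbardSuperconductivity.Theorems.WidthHaldaneColumnFactorisationExact
import Summits.HubbardSuperconductivity.HubbardSuperconductivity.Theorems.WidthHaldaneFeshbachStep

/-!
# Strategist sketch, re-exam round r1 (EXEMPT-46 / BC2-redirect rubric) for crux `WidthHaldaneBridge`
# (stmt-HubbardSuperconductivity-16311)

Planner `planner-cstrat-stmt-HubbardSuperconductivity-16311-r1-0` (crux-strategist, re-exam r1,
2026-08-17). NOT a registered line and NOT a filed split. This file types the decompositions examined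
in `STRATEGY-CENSUS.md` (r1) under the redirect rubric (a) k ≥ 2 load-bearing pieces, (b) assembly
proved, (c) no piece gives the crux `X` or the summit `S` on its own, (d) a plan per open piece — and
kernel-checks every seam and every "consequence of the crux" claim, so that each census row points at
an elaborated object. No `sorry`; conjecture-strength statements are `def … : Prop`, never asserted.
The companion `bc/Probes.lean` runs the mechanical (c)-probes `piece → X`, `piece → S`.

Vocabulary: the landed `Theorems/WidthHaldaneDefs.lean` (`UniformThermo`, `HaldaneLaw`,
`tubeColumnPairCorr`, …); §0 recalls verbatim from the gen-1 sketch `StrategistSketchG1.lean`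
(`HaldaneLawLM`, `UniformLROLM`, `SubExpBridge`, `ExpBridge`, `DiagonalBridge`, the D1 seams).

Contents
* §1 EXPONENT CUT `X ⟺ BudgetBridge ∧ HaldaneSharpening`: the Haldane-relation content of the crux
  (exponent `Ξ√(ẽ″/ρ̃)/M`, tracking the thermodynamic Luttinger number) separates LOSSLESSLY from the
  budget law (exponent `C/M`); `WidthHaldane.closes` consumes only the budget law (its step (1)), so
  `HaldaneSharpening` is decorative for `S`.
* §2 HYPOTHESIS-REGIME CUT `X ⟺ X|_{U ≤ U₀} ∧ X|_{U > U₀}` (trivial seam; recorded for the rubric).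
* §3 SUMMED CUT: `SummedOrderLM` (`‖Δψ‖² = Σ_r G_ψ(r) ≥ A·L²·M²`), `SummedSubExpBridge` (S₁),
  `PointwiseFromSummed` (S₂); `S₁ ∧ S₂ → SubExpBridge` and **`SubExpBridge → S₁`** (counting the
  `≤ 2R` short displacements against the kinematic bound `|G_ψ(r)| ≤ 32·L·M²`), so
  `X ⟺ S₁ ∧ S₂ ∧ ExpBridge`; the tower/overlap form `OverlapSubExpBridge → S₁` (Cauchy–Schwarz).
* §4 THE MINIMAL LOAD-BEARING SHADOW: `SummedDiagonalBridge` (SDB: `UniformThermo ⇒ ‖Δ_d ψ‖² ≥ A·L⁴`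
  on the square tori — the SUMMIT'S OWN FUNCTIONAL `⟨Δ_d†Δ_d⟩ ≥ A|Λ|²` made conditional on the tube
  thermodynamics), `X → SDB`, and the kernel-checked re-glue
  **`closes_summed : SummedDiagonalBridge → WidthUniformThermodynamics → HubbardSuperconductivity`**
  (= `WidthHaldane.closes` with steps (1) and the Cauchy–Schwarz half of (3) removed). Every lossless
  cut of `X` has a piece containing SDB; SDB is what the judge should grade.
* §5 Drop-in raw signature `SummedDiagonalBridgeRaw` (route `let`-vocabulary, `Iff.rfl`-faithful) for
  the tenure planner's re-glue (census R1′).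
-/

noncomputable section

namespace Summit.HubbardSuperconductivity.HubbardSuperconductivity.Cruxes.WidthHaldaneBridge.StrategistR1

set_option linter.dupNamespace false

open scoped BigOperators Classical Matrix ComplexConjugate
open Matrix Literature.MathematicalPhysics.QuantumLattice
open Summit.HubbardSuperconductivity.HubbardSuperconductivity.Theorems.WidthHaldane
open Summit.HubbardSuperconductivity.HubbardSuperconductivity.Theses.WidthHaldane
  (WidthHaldaneBridge WidthUniformThermodynamics)

/-! ## §0 Recalled verbatim from `StrategistSketchG1.lean` (gen 1; that Cruxes module is not built on
the farm, so its content is inlined here instead of imported): the `(L, M)`-slices, the D1 cut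
`SubExpBridge ∧ ExpBridge ⟺ X`, and `DiagonalBridge`. -/

/-- The Haldane-form law at ONE pair `(L, M)` with constants `(Ξ, A, R)`: the matrix of
`HaldaneLaw` with both sizes fixed. [cite: Haldane1981, eqs. (4)–(7)] -/
def HaldaneLawLM (U δ : ℝ) (L M : ℕ) [NeZero L] [NeZero M] (Ξ A : ℝ) (R : ℕ) : Prop :=
  ∀ (Λ : Type) [LinearOrder Λ] [Fintype Λ] (e : Λ ≃ ZMod L × ZMod M), ∀ ψ : Fock (Orb Λ),
    star ψ ⬝ᵥ ψ = 1 → IsGroundStateInSector (tubeH0 L M Λ e U) (tubeFilling L M δ) 0 ψ →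
      ∀ r : ZMod L, R ≤ r.val → r.val + R ≤ L →
        A * (L : ℝ) * (M : ℝ) ^ 2 * ((min r.val (L - r.val) : ℕ) : ℝ) ^
            (-(Ξ * Real.sqrt (tubePairCompressibility L M Λ e U δ / tubeStiffness L M Λ e U δ) /
              (M : ℝ))) ≤ tubeColumnPairCorr L M Λ e ψ r

/-- EXPONENT-FREE uniform column-pair long-range order at ONE pair `(L, M)`: every normalised sector
ground state of the untwisted tube has `G_ψ(r) ≥ A·L·M²` at every displacement with `R ≤ r̂`
(the kinematic maximum is `32·L·M²`, `Theorems.WidthHaldane.tubeColumnPairCorr_zero_le`).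
[cite: Scalapino1995, §2 eq. (2.4)] -/
def UniformLROLM (U δ : ℝ) (L M : ℕ) [NeZero L] [NeZero M] (A : ℝ) (R : ℕ) : Prop :=
  ∀ (Λ : Type) [LinearOrder Λ] [Fintype Λ] (e : Λ ≃ ZMod L × ZMod M), ∀ ψ : Fock (Orb Λ),
    star ψ ⬝ᵥ ψ = 1 → IsGroundStateInSector (tubeH0 L M Λ e U) (tubeFilling L M δ) 0 ψ →
      ∀ r : ZMod L, R ≤ r.val → r.val + R ≤ L →
        A * (L : ℝ) * (M : ℝ) ^ 2 ≤ tubeColumnPairCorr L M Λ e ψ r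

/-- Binder shuffle: the crux's conclusion is the conjunction of its `(L, M)` slices. [folklore] -/
theorem haldaneLaw_iff_LM (U δ Ξ A : ℝ) (R M₂ L₁ : ℕ) :
    HaldaneLaw U δ Ξ A R M₂ L₁ ↔ ∀ (L M : ℕ) [NeZero L] [NeZero M], Even L → Even M → M₂ ≤ M →
      M ≤ L → L₁ ≤ L → HaldaneLawLM U δ L M Ξ A R :=
  Iff.rfl

/-! ## DECOMPOSITION D1: the `(L, M)`-plane cut at `L = e^M` -/

/-- D1a — SUB-EXPONENTIAL TUBES CARRY PLAIN LRO: under width-uniform thermodynamics, on every even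
tube whose length is at most exponential in its width (`L ≤ e^M`, which includes every square, every
bounded-aspect-ratio and every polynomially elongated tube) EVERY normalised sector ground state has
exponent-free uniform column d-wave pair coherence `G_ψ(r) ≥ A·L·M²` down to `r̂ ≍ L`, with
width-uniform `A, R`. A CONSEQUENCE of the crux (`subExpBridge_of_widthHaldaneBridge`): the factor
`r̂^{-Ξ√(ẽ″/ρ̃)/M} ≥ e^{-Ξ√(k₀/d₀)}` as soon as `log r̂ ≤ M`. Conjecture-strength (its `M = L`
slice is `DiagonalBridge`, 2D d-wave pair LRO at every window point with uniform thermodynamics).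
[cite: Scalapino1995, §2 eq. (2.4)] [cite: Haldane1981, eqs. (4)–(7)] -/
def SubExpBridge : Prop :=
  ∀ U : ℝ, 0 < U → ∀ δ ∈ Set.Ioo (0 : ℝ) (3 / 10), ∀ (d₀ k₀ : ℝ) (M₁ L₀ : ℕ), 0 < d₀ →
    UniformThermo U δ d₀ k₀ M₁ L₀ →
      ∃ A : ℝ, 0 < A ∧ ∃ R M₂ L₁ : ℕ, ∀ (L M : ℕ) [NeZero L] [NeZero M], Even L → Even M →
        M₂ ≤ M → M ≤ L → L₁ ≤ L → (L : ℝ) ≤ Real.exp (M : ℝ) → UniformLROLM U δ L M A R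

/-- D1b — EXPONENTIALLY ELONGATED TUBES CARRY THE LUTTINGER DECAY: under width-uniform
thermodynamics, the Haldane-form law with width-uniform constants on every even tube with
`L > e^M` — the only sub-family on which the crux's power law is not equivalent to plain LRO.
A consequence of the crux by restriction (`expBridge_of_widthHaldaneBridge`); conjecture-strength
(width-uniform multiband Luther–Emery universality; note that even here `r̂ = R` asks transverse
coherence `G ≍ L·M²` of tubes of unbounded width). [cite: Haldane1981, eqs. (4)–(7)]
[cite: BenfattoFalcoMastropietro2010, Theorem p. 3] -/
def ExpBridge : Prop :=
  ∀ U : ℝ, 0 < U → ∀ δ ∈ Set.Ioo (0 : ℝ) (3 / 10), ∀ (d₀ k₀ : ℝ) (M₁ L₀ : ℕ), 0 < d₀ →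
    UniformThermo U δ d₀ k₀ M₁ L₀ →
      ∃ Ξ : ℝ, 0 < Ξ ∧ ∃ A : ℝ, 0 < A ∧ ∃ R M₂ L₁ : ℕ, ∀ (L M : ℕ) [NeZero L] [NeZero M],
        Even L → Even M → M₂ ≤ M → M ≤ L → L₁ ≤ L → Real.exp (M : ℝ) < (L : ℝ) →
          HaldaneLawLM U δ L M Ξ A R

/-- Real-variable core of F4: if `1 ≤ m`, `log m ≤ Mr`, `0 ≤ s` and `Ξ·s ≤ C` with `Ξ ≥ 0`,
`Mr > 0`, then `e^{-C} ≤ m^{-Ξ s / Mr}`. [folklore] -/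
theorem exp_neg_le_rpow {m Mr s Ξ C : ℝ} (hm : 1 ≤ m) (hlog : Real.log m ≤ Mr) (hs : 0 ≤ s)
    (hΞ : 0 ≤ Ξ) (hsC : Ξ * s ≤ C) (hMr : 0 < Mr) :
    Real.exp (-C) ≤ m ^ (-(Ξ * s / Mr)) := by
  have hm0 : 0 < m := one_pos.trans_le hm
  rw [Real.rpow_def_of_pos hm0]
  apply Real.exp_le_exp.2
  have hlog0 : 0 ≤ Real.log m := Real.log_nonneg hm
  have h1 : Real.log m * (Ξ * s / Mr) ≤ Mr * (Ξ * s / Mr) :=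
    mul_le_mul_of_nonneg_right hlog (by positivity)
  have h2 : Mr * (Ξ * s / Mr) = Ξ * s := by field_simp
  rw [h2] at h1
  have h3 : Real.log m * -(Ξ * s / Mr) = -(Real.log m * (Ξ * s / Mr)) := by ring
  rw [h3]
  linarith

/-- **F4 / D1a is a consequence of the crux.** [folklore] -/
theorem subExpBridge_of_widthHaldaneBridge (h : WidthHaldaneBridge) : SubExpBridge := by
  rw [widthHaldaneBridge_iff] at h
  intro U hU δ hδ d₀ k₀ M₁ L₀ hd₀ hth
  obtain ⟨Ξ, hΞ, A, hA, R, M₂, L₁, hlaw⟩ := h U hU δ hδ d₀ k₀ M₁ L₀ hd₀ hth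
  refine ⟨A * Real.exp (-(Ξ * Real.sqrt (k₀ / d₀))), by positivity, max R 1, max M₂ M₁,
    max L₁ L₀, ?_⟩
  intro L M _ _ hLe hMe hM hML hL hexp Λ _ _ e ψ hψ hGS r hr hrL
  obtain ⟨hstiff, hic0, hick⟩ :=
    hth L M hLe hMe (le_of_max_le_right hM) hML (le_of_max_le_right hL) Λ e
  have key := hlaw L M hLe hMe (le_of_max_le_left hM) hML (le_of_max_le_left hL) Λ e ψ hψ hGS r
    ((le_max_left R 1).trans hr) (le_trans (Nat.add_le_add_left (le_max_left R 1) _) hrL)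
  refine le_trans ?_ key
  -- the displacement `m = r̂` satisfies `1 ≤ m ≤ L ≤ e^M`
  have hm1 : (1 : ℝ) ≤ ((min r.val (L - r.val) : ℕ) : ℝ) := by
    have h1 : 1 ≤ r.val := (le_max_right R 1).trans hr
    have h2 : 1 ≤ L - r.val := by
      have := le_trans (Nat.add_le_add_left (le_max_right R 1) _) hrL
      omega
    exact_mod_cast le_min h1 h2
  have hmL : ((min r.val (L - r.val) : ℕ) : ℝ) ≤ (L : ℝ) := by
    have : min r.val (L - r.val) ≤ L := (min_le_right _ _).trans (Nat.sub_le _ _)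
    exact_mod_cast this
  have hMpos : (0 : ℝ) < (M : ℝ) := by exact_mod_cast Nat.pos_of_ne_zero (NeZero.ne M)
  have hlog : Real.log ((min r.val (L - r.val) : ℕ) : ℝ) ≤ (M : ℝ) := by
    have hm0 : (0 : ℝ) < ((min r.val (L - r.val) : ℕ) : ℝ) := one_pos.trans_le hm1
    calc Real.log ((min r.val (L - r.val) : ℕ) : ℝ) ≤ Real.log (Real.exp (M : ℝ)) :=
          Real.log_le_log hm0 (hmL.trans hexp)
      _ = (M : ℝ) := Real.log_exp _
  have hk₀ : 0 < k₀ := hic0.trans_le hick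
  have hs : Real.sqrt (tubePairCompressibility L M Λ e U δ / tubeStiffness L M Λ e U δ) ≤
      Real.sqrt (k₀ / d₀) := by
    apply Real.sqrt_le_sqrt
    rw [div_le_div_iff₀ (hd₀.trans_le hstiff) hd₀]
    calc _ ≤ k₀ * d₀ := mul_le_mul_of_nonneg_right hick hd₀.le
      _ ≤ k₀ * _ := mul_le_mul_of_nonneg_left hstiff hk₀.le
  have hcore := exp_neg_le_rpow hm1 hlog (Real.sqrt_nonneg _) hΞ.le
    (mul_le_mul_of_nonneg_left hs hΞ.le) hMpos
  have hLM : (0 : ℝ) ≤ A * (L : ℝ) * (M : ℝ) ^ 2 := by positivity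
  calc A * Real.exp (-(Ξ * Real.sqrt (k₀ / d₀))) * (L : ℝ) * (M : ℝ) ^ 2
        = A * (L : ℝ) * (M : ℝ) ^ 2 * Real.exp (-(Ξ * Real.sqrt (k₀ / d₀))) := by ring
    _ ≤ A * (L : ℝ) * (M : ℝ) ^ 2 * ((min r.val (L - r.val) : ℕ) : ℝ) ^
          (-(Ξ * Real.sqrt (tubePairCompressibility L M Λ e U δ / tubeStiffness L M Λ e U δ) /
            (M : ℝ))) := mul_le_mul_of_nonneg_left hcore hLM

/-- D1b is a consequence of the crux (restriction). [folklore] -/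
theorem expBridge_of_widthHaldaneBridge (h : WidthHaldaneBridge) : ExpBridge := by
  rw [widthHaldaneBridge_iff] at h
  intro U hU δ hδ d₀ k₀ M₁ L₀ hd₀ hth
  obtain ⟨Ξ, hΞ, A, hA, R, M₂, L₁, hlaw⟩ := h U hU δ hδ d₀ k₀ M₁ L₀ hd₀ hth
  refine ⟨Ξ, hΞ, A, hA, R, M₂, L₁, ?_⟩
  intro L M _ _ hLe hMe hM hML hL _ Λ _ _ e ψ hψ hGS r hr hrL
  exact hlaw L M hLe hMe hM hML hL Λ e ψ hψ hGS r hr hrL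

/-- **The cut is lossless**: D1a ∧ D1b ⇒ the crux (case split on `L ≤ e^M`; on the sub-exponential
side the exponent-free bound dominates the Haldane-form one because `r̂^{-x} ≤ 1` for `r̂ ≥ 1`,
`x ≥ 0`). [folklore] -/
theorem widthHaldaneBridge_of_subExp_of_exp (h1 : SubExpBridge) (h2 : ExpBridge) :
    WidthHaldaneBridge := by
  rw [widthHaldaneBridge_iff]
  intro U hU δ hδ d₀ k₀ M₁ L₀ hd₀ hth
  obtain ⟨A₁, hA₁, R₁, M₂, L₁, hsub⟩ := h1 U hU δ hδ d₀ k₀ M₁ L₀ hd₀ hth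
  obtain ⟨Ξ, hΞ, A₂, hA₂, R₂, M₂', L₁', hexp⟩ := h2 U hU δ hδ d₀ k₀ M₁ L₀ hd₀ hth
  refine ⟨Ξ, hΞ, min A₁ A₂, lt_min hA₁ hA₂, max (max R₁ R₂) 1, max M₂ M₂', max L₁ L₁', ?_⟩
  intro L M _ _ hLe hMe hM hML hL Λ _ _ e ψ hψ hGS r hr hrL
  have hR1 : R₁ ≤ r.val := ((le_max_left R₁ R₂).trans (le_max_left _ 1)).trans hr
  have hR1' : r.val + R₁ ≤ L :=
    le_trans (Nat.add_le_add_left ((le_max_left R₁ R₂).trans (le_max_left _ 1)) _) hrL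
  have hR2 : R₂ ≤ r.val := ((le_max_right R₁ R₂).trans (le_max_left _ 1)).trans hr
  have hR2' : r.val + R₂ ≤ L :=
    le_trans (Nat.add_le_add_left ((le_max_right R₁ R₂).trans (le_max_left _ 1)) _) hrL
  have hm1 : (1 : ℝ) ≤ ((min r.val (L - r.val) : ℕ) : ℝ) := by
    have h1 : 1 ≤ r.val := (le_max_right _ 1).trans hr
    have h2 : 1 ≤ L - r.val := by
      have := le_trans (Nat.add_le_add_left (le_max_right (max R₁ R₂) 1) _) hrL
      omega
    exact_mod_cast le_min h1 h2
  have hMpos : (0 : ℝ) < (M : ℝ) := by exact_mod_cast Nat.pos_of_ne_zero (NeZero.ne M)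
  set x : ℝ := Ξ * Real.sqrt (tubePairCompressibility L M Λ e U δ / tubeStiffness L M Λ e U δ) /
    (M : ℝ) with hx
  have hx0 : 0 ≤ x := by positivity
  have hpow1 : ((min r.val (L - r.val) : ℕ) : ℝ) ^ (-x) ≤ 1 :=
    Real.rpow_le_one_of_one_le_of_nonpos hm1 (by linarith)
  have hpow0 : 0 ≤ ((min r.val (L - r.val) : ℕ) : ℝ) ^ (-x) :=
    Real.rpow_nonneg (zero_le_one.trans hm1) _
  have hLM : (0 : ℝ) ≤ (L : ℝ) * (M : ℝ) ^ 2 := by positivity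
  by_cases hc : (L : ℝ) ≤ Real.exp (M : ℝ)
  · have key := hsub L M hLe hMe (le_of_max_le_left hM) hML (le_of_max_le_left hL) hc Λ e ψ hψ
      hGS r hR1 hR1'
    calc min A₁ A₂ * (L : ℝ) * (M : ℝ) ^ 2 * ((min r.val (L - r.val) : ℕ) : ℝ) ^ (-x)
          ≤ A₁ * (L : ℝ) * (M : ℝ) ^ 2 * 1 := by
            apply mul_le_mul _ hpow1 hpow0 (by positivity)
            have : min A₁ A₂ ≤ A₁ := min_le_left _ _
            nlinarith
      _ = A₁ * (L : ℝ) * (M : ℝ) ^ 2 := by ring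
      _ ≤ _ := key
  · have hc' : Real.exp (M : ℝ) < (L : ℝ) := lt_of_not_ge hc
    have key := hexp L M hLe hMe (le_of_max_le_right hM) hML (le_of_max_le_right hL) hc' Λ e ψ
      hψ hGS r hR2 hR2'
    calc min A₁ A₂ * (L : ℝ) * (M : ℝ) ^ 2 * ((min r.val (L - r.val) : ℕ) : ℝ) ^ (-x)
          ≤ A₂ * (L : ℝ) * (M : ℝ) ^ 2 * ((min r.val (L - r.val) : ℕ) : ℝ) ^ (-x) := by
            apply mul_le_mul_of_nonneg_right _ hpow0
            apply mul_le_mul_of_nonneg_right _ (sq_nonneg _)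
            exact mul_le_mul_of_nonneg_right (min_le_right _ _) (Nat.cast_nonneg L)
      _ ≤ _ := key

/-! ## F1 made actionable: the diagonal, exponent-free shadow the route consumes -/

/-- **DIAGONAL BRIDGE** — the part of the crux that `WidthHaldane.closes` actually consumes
(re-glue certificate `closes_diag` below): for every `U > 0`, `δ ∈ (0, 3/10)` and data, width-uniform
tube thermodynamics forces UNIFORM COLUMN `d_{x²-y²}` PAIR LRO OF THE SQUARE TORI — every normalised
sector ground state of the pure `L × L` Hubbard torus has `G_ψ(r) ≥ A·L³` for `R ≤ r̂`, `L ≥ L₁`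
even. Exponent-free; the `M = L` slice of `SubExpBridge`; a consequence of the crux
(`diagonalBridge_of_widthHaldaneBridge`). Open-problem strength: it is "superfluid stiffness (+ pair
compressibility) ⇒ d-wave pair ODLRO" for the 2D Hubbard ground state, the converse-Sewell direction
shared with `FluxSpectroscopy.FluxBridge`, plus `d_{x²-y²}` selection. [cite: Scalapino1995, §2 eq. (2.4)]
[cite: ScalapinoWhiteZhang1993, §II] -/
def DiagonalBridge : Prop :=
  ∀ U : ℝ, 0 < U → ∀ δ ∈ Set.Ioo (0 : ℝ) (3 / 10), ∀ (d₀ k₀ : ℝ) (M₁ L₀ : ℕ), 0 < d₀ →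
    UniformThermo U δ d₀ k₀ M₁ L₀ →
      ∃ A : ℝ, 0 < A ∧ ∃ R L₁ : ℕ, ∀ (L : ℕ) [NeZero L], Even L → L₁ ≤ L → UniformLROLM U δ L L A R

/-- The crux implies its diagonal shadow (via D1a at `M = L`, since `L ≤ e^L`). [folklore] -/
theorem diagonalBridge_of_widthHaldaneBridge (h : WidthHaldaneBridge) : DiagonalBridge := by
  intro U hU δ hδ d₀ k₀ M₁ L₀ hd₀ hth
  obtain ⟨A, hA, R, M₂, L₁, hsub⟩ := subExpBridge_of_widthHaldaneBridge h U hU δ hδ d₀ k₀ M₁ L₀ hd₀ hth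
  refine ⟨A, hA, R, max M₂ L₁, ?_⟩
  intro L _ hLe hL
  have hexp : (L : ℝ) ≤ Real.exp (L : ℝ) := by
    have := Real.add_one_le_exp (L : ℝ)
    linarith
  exact hsub L L hLe hLe (le_of_max_le_left hL) le_rfl (le_of_max_le_right hL) hexp

/-! ## §1 The exponent cut: budget law ∧ Haldane sharpening -/

/-- The BUDGET law at one `(L, M)`: `A·L·M²·r̂^{-C/M} ≤ G_ψ(r)` for `R ≤ r̂` — the crux's law with the
thermodynamic exponent `Ξ√(ẽ″/ρ̃)/M` replaced by a width-shrinking budget `C/M` that does NOT track the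
tube's Luttinger number. [cite: Haldane1981, eqs. (4)–(7)] -/
def BudgetLawLM (U δ : ℝ) (L M : ℕ) [NeZero L] [NeZero M] (C A : ℝ) (R : ℕ) : Prop :=
  ∀ (Λ : Type) [LinearOrder Λ] [Fintype Λ] (e : Λ ≃ ZMod L × ZMod M), ∀ ψ : Fock (Orb Λ),
    star ψ ⬝ᵥ ψ = 1 → IsGroundStateInSector (tubeH0 L M Λ e U) (tubeFilling L M δ) 0 ψ →
      ∀ r : ZMod L, R ≤ r.val → r.val + R ≤ L →
        A * (L : ℝ) * (M : ℝ) ^ 2 * ((min r.val (L - r.val) : ℕ) : ℝ) ^ (-(C / (M : ℝ))) ≤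
          tubeColumnPairCorr L M Λ e ψ r

/-- **X⁻ = BUDGET BRIDGE**: `UniformThermo ⇒` the budget law with width-uniform `(C, A, R)` on every
admissible tube. A consequence of the crux (`budgetBridge_of_widthHaldaneBridge`, = step (1) of
`WidthHaldane.closes`) and ALL that `closes` reads from the crux; conjecture-strength (its diagonal is
`DiagonalBridge`/`SummedDiagonalBridge`). [cite: Haldane1981, eqs. (4)–(7)] -/
def BudgetBridge : Prop :=
  ∀ U : ℝ, 0 < U → ∀ δ ∈ Set.Ioo (0 : ℝ) (3 / 10), ∀ (d₀ k₀ : ℝ) (M₁ L₀ : ℕ), 0 < d₀ →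
    UniformThermo U δ d₀ k₀ M₁ L₀ →
      ∃ C : ℝ, 0 ≤ C ∧ ∃ A : ℝ, 0 < A ∧ ∃ R M₂ L₁ : ℕ, ∀ (L M : ℕ) [NeZero L] [NeZero M],
        Even L → Even M → M₂ ≤ M → M ≤ L → L₁ ≤ L → BudgetLawLM U δ L M C A R

/-- **H = HALDANE SHARPENING**: under `UniformThermo`, IF the tube family obeys a budget law THEN it
obeys the Haldane-form law whose exponent is governed by the thermodynamic Luttinger number
`K̂ = M√(ρ̃/ẽ″)`. This is the Luttinger-universality content of the crux in isolation (it presupposes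
order/quasi-order and identifies the exponent); non-vacuous exactly where `ẽ″_{L,M} → 0⁺` cofinally
(gen-1 census N1). Decorative for the summit: `closes` never reads it. Sibling theorem: the Haldane
relations for non-solvable spinless chains. [cite: BenfattoFalcoMastropietro2010, Theorem p. 3]
[cite: Haldane1981, eqs. (4)–(7)] -/
def HaldaneSharpening : Prop :=
  ∀ U : ℝ, 0 < U → ∀ δ ∈ Set.Ioo (0 : ℝ) (3 / 10), ∀ (d₀ k₀ : ℝ) (M₁ L₀ : ℕ), 0 < d₀ →
    UniformThermo U δ d₀ k₀ M₁ L₀ →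
      (∃ C : ℝ, 0 ≤ C ∧ ∃ A : ℝ, 0 < A ∧ ∃ R M₂ L₁ : ℕ, ∀ (L M : ℕ) [NeZero L] [NeZero M],
        Even L → Even M → M₂ ≤ M → M ≤ L → L₁ ≤ L → BudgetLawLM U δ L M C A R) →
      ∃ Ξ : ℝ, 0 < Ξ ∧ ∃ A : ℝ, 0 < A ∧ ∃ R M₂ L₁ : ℕ, HaldaneLaw U δ Ξ A R M₂ L₁

/-- `X → X⁻` (rpow monotonicity with the budget `C := Ξ√(k₀/d₀)`, `exponent_le_budget`). [folklore] -/
theorem budgetBridge_of_widthHaldaneBridge (h : WidthHaldaneBridge) : BudgetBridge := by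
  rw [widthHaldaneBridge_iff] at h
  intro U hU δ hδ d₀ k₀ M₁ L₀ hd₀ hth
  obtain ⟨Ξ, hΞ, A, hA, R, M₂, L₁, hlaw⟩ := h U hU δ hδ d₀ k₀ M₁ L₀ hd₀ hth
  refine ⟨Ξ * Real.sqrt (k₀ / d₀), by positivity, A, hA, max R 1, max M₂ M₁, max L₁ L₀, ?_⟩
  intro L M _ _ hLe hMe hM hML hL Λ _ _ e ψ hψ hGS r hr hrL
  obtain ⟨hstiff, hic0, hick⟩ :=
    hth L M hLe hMe (le_of_max_le_right hM) hML (le_of_max_le_right hL) Λ e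
  have key := hlaw L M hLe hMe (le_of_max_le_left hM) hML (le_of_max_le_left hL) Λ e ψ hψ hGS r
    ((le_max_left R 1).trans hr) (le_trans (Nat.add_le_add_left (le_max_left R 1) _) hrL)
  refine le_trans ?_ key
  have hmin : (1 : ℝ) ≤ ((min r.val (L - r.val) : ℕ) : ℝ) := by
    have h1 : 1 ≤ r.val := (le_max_right R 1).trans hr
    have h2 : 1 ≤ L - r.val := by
      have := le_trans (Nat.add_le_add_left (le_max_right R 1) _) hrL
      omega
    exact_mod_cast le_min h1 h2
  have hMpos : (0 : ℝ) < (M : ℝ) := by exact_mod_cast Nat.pos_of_ne_zero (NeZero.ne M)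
  have hM1 : (1 : ℝ) ≤ (M : ℝ) := by exact_mod_cast Nat.pos_of_ne_zero (NeZero.ne M)
  gcongr A * (L : ℝ) * (M : ℝ) ^ 2 * ?_
  apply Real.rpow_le_rpow_of_exponent_le hmin
  rw [neg_le_neg_iff]
  apply div_le_div_of_nonneg_right _ hMpos.le
  apply mul_le_mul_of_nonneg_left _ hΞ.le
  apply Real.sqrt_le_sqrt
  have hk₀ : 0 < k₀ := hic0.trans_le hick
  rw [div_le_div_iff₀ (hd₀.trans_le hstiff) hd₀]
  calc _ ≤ k₀ * d₀ := mul_le_mul_of_nonneg_right hick hd₀.le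
    _ ≤ k₀ * _ := mul_le_mul_of_nonneg_left hstiff hk₀.le

/-- `X → H` (the conclusion holds outright). [folklore] -/
theorem haldaneSharpening_of_widthHaldaneBridge (h : WidthHaldaneBridge) : HaldaneSharpening := by
  rw [widthHaldaneBridge_iff] at h
  intro U hU δ hδ d₀ k₀ M₁ L₀ hd₀ hth _
  exact h U hU δ hδ d₀ k₀ M₁ L₀ hd₀ hth

/-- **The exponent cut is lossless and its seam is modus ponens** (`trivial_seam`). [folklore] -/
theorem widthHaldaneBridge_of_budget_of_sharpening (h1 : BudgetBridge) (h2 : HaldaneSharpening) :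
    WidthHaldaneBridge := by
  rw [widthHaldaneBridge_iff]
  intro U hU δ hδ d₀ k₀ M₁ L₀ hd₀ hth
  exact h2 U hU δ hδ d₀ k₀ M₁ L₀ hd₀ hth (h1 U hU δ hδ d₀ k₀ M₁ L₀ hd₀ hth)

theorem widthHaldaneBridge_iff_budget_and_sharpening :
    WidthHaldaneBridge ↔ BudgetBridge ∧ HaldaneSharpening :=
  ⟨fun h => ⟨budgetBridge_of_widthHaldaneBridge h, haldaneSharpening_of_widthHaldaneBridge h⟩,
    fun h => widthHaldaneBridge_of_budget_of_sharpening h.1 h.2⟩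

/-- `X⁻` already carries the exponent-free order of the sub-exponential tubes (hence `DiagonalBridge`):
on `L ≤ e^M`, `r̂^{-C/M} ≥ e^{-C}`. [folklore] -/
theorem subExpBridge_of_budgetBridge (h : BudgetBridge) : SubExpBridge := by
  intro U hU δ hδ d₀ k₀ M₁ L₀ hd₀ hth
  obtain ⟨C, hC, A, hA, R, M₂, L₁, hlaw⟩ := h U hU δ hδ d₀ k₀ M₁ L₀ hd₀ hth
  refine ⟨A * Real.exp (-C), by positivity, max R 1, M₂, L₁, ?_⟩
  intro L M _ _ hLe hMe hM hML hL hexp Λ _ _ e ψ hψ hGS r hr hrL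
  have key := hlaw L M hLe hMe hM hML hL Λ e ψ hψ hGS r ((le_max_left R 1).trans hr)
    (le_trans (Nat.add_le_add_left (le_max_left R 1) _) hrL)
  refine le_trans ?_ key
  have hm1 : (1 : ℝ) ≤ ((min r.val (L - r.val) : ℕ) : ℝ) := by
    have h1 : 1 ≤ r.val := (le_max_right R 1).trans hr
    have h2 : 1 ≤ L - r.val := by
      have := le_trans (Nat.add_le_add_left (le_max_right R 1) _) hrL
      omega
    exact_mod_cast le_min h1 h2
  have hmL : ((min r.val (L - r.val) : ℕ) : ℝ) ≤ (L : ℝ) := by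
    have : min r.val (L - r.val) ≤ L := (min_le_right _ _).trans (Nat.sub_le _ _)
    exact_mod_cast this
  have hMpos : (0 : ℝ) < (M : ℝ) := by exact_mod_cast Nat.pos_of_ne_zero (NeZero.ne M)
  have hlog : Real.log ((min r.val (L - r.val) : ℕ) : ℝ) ≤ (M : ℝ) := by
    have hm0 : (0 : ℝ) < ((min r.val (L - r.val) : ℕ) : ℝ) := one_pos.trans_le hm1
    calc Real.log ((min r.val (L - r.val) : ℕ) : ℝ) ≤ Real.log (Real.exp (M : ℝ)) :=
          Real.log_le_log hm0 (hmL.trans hexp)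
      _ = (M : ℝ) := Real.log_exp _
  -- `e^{-C} ≤ m^{-C/M}` from `exp_neg_le_rpow` with `Ξ := 1`, `s := C`
  have hcore := exp_neg_le_rpow (Ξ := 1) (s := C) (C := C) hm1 hlog hC zero_le_one (by simp) hMpos
  have hLM : (0 : ℝ) ≤ A * (L : ℝ) * (M : ℝ) ^ 2 := by positivity
  calc A * Real.exp (-C) * (L : ℝ) * (M : ℝ) ^ 2
        = A * (L : ℝ) * (M : ℝ) ^ 2 * Real.exp (-C) := by ring
    _ ≤ A * (L : ℝ) * (M : ℝ) ^ 2 * ((min r.val (L - r.val) : ℕ) : ℝ) ^ (-(1 * C / (M : ℝ))) :=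
        mul_le_mul_of_nonneg_left hcore hLM
    _ = A * (L : ℝ) * (M : ℝ) ^ 2 * ((min r.val (L - r.val) : ℕ) : ℝ) ^ (-(C / (M : ℝ))) := by
        rw [one_mul]

theorem diagonalBridge_of_budgetBridge (h : BudgetBridge) : DiagonalBridge := by
  intro U hU δ hδ d₀ k₀ M₁ L₀ hd₀ hth
  obtain ⟨A, hA, R, M₂, L₁, hsub⟩ := subExpBridge_of_budgetBridge h U hU δ hδ d₀ k₀ M₁ L₀ hd₀ hth
  refine ⟨A, hA, R, max M₂ L₁, ?_⟩
  intro L _ hLe hL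
  have hexp : (L : ℝ) ≤ Real.exp (L : ℝ) := by
    have := Real.add_one_le_exp (L : ℝ)
    linarith
  exact hsub L L hLe hLe (le_of_max_le_left hL) le_rfl (le_of_max_le_right hL) hexp

/-! ## §2 The hypothesis-regime cut (weak / strong coupling) -/

/-- The crux restricted to couplings `U ≤ U₀`. [folklore] -/
def WeakCouplingPiece (U₀ : ℝ) : Prop :=
  ∀ U : ℝ, 0 < U → U ≤ U₀ → ∀ δ ∈ Set.Ioo (0 : ℝ) (3 / 10), ∀ (d₀ k₀ : ℝ) (M₁ L₀ : ℕ), 0 < d₀ →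
    UniformThermo U δ d₀ k₀ M₁ L₀ →
      ∃ Ξ : ℝ, 0 < Ξ ∧ ∃ A : ℝ, 0 < A ∧ ∃ R M₂ L₁ : ℕ, HaldaneLaw U δ Ξ A R M₂ L₁

/-- The crux restricted to couplings `U₀ < U`. [folklore] -/
def StrongCouplingPiece (U₀ : ℝ) : Prop :=
  ∀ U : ℝ, 0 < U → U₀ < U → ∀ δ ∈ Set.Ioo (0 : ℝ) (3 / 10), ∀ (d₀ k₀ : ℝ) (M₁ L₀ : ℕ), 0 < d₀ →
    UniformThermo U δ d₀ k₀ M₁ L₀ →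
      ∃ Ξ : ℝ, 0 < Ξ ∧ ∃ A : ℝ, 0 < A ∧ ∃ R M₂ L₁ : ℕ, HaldaneLaw U δ Ξ A R M₂ L₁

/-- Lossless, trivial seam (case split on `U ≤ U₀`). [folklore] -/
theorem widthHaldaneBridge_iff_weak_and_strong (U₀ : ℝ) :
    WidthHaldaneBridge ↔ WeakCouplingPiece U₀ ∧ StrongCouplingPiece U₀ := by
  rw [widthHaldaneBridge_iff]
  refine ⟨fun h => ⟨fun U hU _ => h U hU, fun U hU _ => h U hU⟩, fun h U hU => ?_⟩
  by_cases hc : U ≤ U₀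
  · exact h.1 U hU hc
  · exact h.2 U hU (lt_of_not_ge hc)

/-! ## §3 The summed cut -/

/-- SUMMED ORDER at one `(L, M)`: every normalised sector ground state has
`Σ_r G_ψ(r) = ‖Δψ‖² ≥ A·L²·M²` (`Δ = Σ_a Φ_a` the total `d_{x²-y²}` pair field; the `k = 0` column
pair structure factor). At `M = L` this is `⟨ψ, Δ_d†Δ_d ψ⟩ ≥ A·|Λ|²` — the summit's LRO functional.
[cite: Scalapino1995, §2 eq. (2.4)] -/
def SummedOrderLM (U δ : ℝ) (L M : ℕ) [NeZero L] [NeZero M] (A : ℝ) : Prop :=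
  ∀ (Λ : Type) [LinearOrder Λ] [Fintype Λ] (e : Λ ≃ ZMod L × ZMod M), ∀ ψ : Fock (Orb Λ),
    star ψ ⬝ᵥ ψ = 1 → IsGroundStateInSector (tubeH0 L M Λ e U) (tubeFilling L M δ) 0 ψ →
      A * (L : ℝ) ^ 2 * (M : ℝ) ^ 2 ≤ ∑ r : ZMod L, tubeColumnPairCorr L M Λ e ψ r

/-- **S₁ = SUMMED SUB-EXPONENTIAL BRIDGE**: `UniformThermo ⇒` extensive `k = 0` column pair
structure factor `‖Δψ‖² ≥ A·L²·M²` on every even tube with `L ≤ e^M`. A consequence of the crux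
(`summedSubExpBridge_of_subExpBridge`); the 2D-order core in the summit's own functional.
[cite: Scalapino1995, §2 eq. (2.4)] -/
def SummedSubExpBridge : Prop :=
  ∀ U : ℝ, 0 < U → ∀ δ ∈ Set.Ioo (0 : ℝ) (3 / 10), ∀ (d₀ k₀ : ℝ) (M₁ L₀ : ℕ), 0 < d₀ →
    UniformThermo U δ d₀ k₀ M₁ L₀ →
      ∃ A : ℝ, 0 < A ∧ ∃ M₂ L₁ : ℕ, ∀ (L M : ℕ) [NeZero L] [NeZero M], Even L → Even M →
        M₂ ≤ M → M ≤ L → L₁ ≤ L → (L : ℝ) ≤ Real.exp (M : ℝ) → SummedOrderLM U δ L M A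

/-- **S₂ = POINTWISE FROM SUMMED** ("no competing `k ≠ 0` pair condensate"): under `UniformThermo`,
a width-uniform summed order on the sub-exponential tubes forces the width-uniform POINTWISE
exponent-free order `G_ψ(r) ≥ A'·L·M²` there. Via the landed Bochner floor
(`tubeColumnPairCorr_ge_of_majority`) it would follow from a `k = 0` MAJORITY of the column pair
structure factor; neither is kinematic (a coexisting `q = π` pair-density wave with equal weight
kills it) and `UniformThermo`'s energies do not see the difference. Conjecture-strength, but NOT
containing the 2D-order core by itself. [cite: Scalapino1995, §2 eq. (2.4)] -/
def PointwiseFromSummed : Prop :=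
  ∀ U : ℝ, 0 < U → ∀ δ ∈ Set.Ioo (0 : ℝ) (3 / 10), ∀ (d₀ k₀ : ℝ) (M₁ L₀ : ℕ), 0 < d₀ →
    UniformThermo U δ d₀ k₀ M₁ L₀ →
      ∀ (A : ℝ) (M₂ L₁ : ℕ), 0 < A →
        (∀ (L M : ℕ) [NeZero L] [NeZero M], Even L → Even M → M₂ ≤ M → M ≤ L → L₁ ≤ L →
          (L : ℝ) ≤ Real.exp (M : ℝ) → SummedOrderLM U δ L M A) →
        ∃ A' : ℝ, 0 < A' ∧ ∃ R M₂' L₁' : ℕ, ∀ (L M : ℕ) [NeZero L] [NeZero M], Even L → Even M →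
          M₂' ≤ M → M ≤ L → L₁' ≤ L → (L : ℝ) ≤ Real.exp (M : ℝ) → UniformLROLM U δ L M A' R

/-- `S₁ ∧ S₂ → SubExpBridge` (modus ponens). [folklore] -/
theorem subExpBridge_of_summed_of_pointwise (h1 : SummedSubExpBridge) (h2 : PointwiseFromSummed) :
    SubExpBridge := by
  intro U hU δ hδ d₀ k₀ M₁ L₀ hd₀ hth
  obtain ⟨A, hA, M₂, L₁, hsum⟩ := h1 U hU δ hδ d₀ k₀ M₁ L₀ hd₀ hth
  exact h2 U hU δ hδ d₀ k₀ M₁ L₀ hd₀ hth A M₂ L₁ hA hsum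

/-- `SubExpBridge → S₂` (the conclusion holds outright). [folklore] -/
theorem pointwiseFromSummed_of_subExpBridge (h : SubExpBridge) : PointwiseFromSummed := by
  intro U hU δ hδ d₀ k₀ M₁ L₀ hd₀ hth _ _ _ _ _
  exact h U hU δ hδ d₀ k₀ M₁ L₀ hd₀ hth

/-- Counting/summing core: if `|G r| ≤ B` for all `r : ZMod L` and `X ≤ G r` whenever
`R ≤ r.val ∧ r.val + R ≤ L`, then `Σ_r G r ≥ (L - 2R)·X - 2R·B` (for `X ≥ 0`). [folklore] -/
theorem sum_ge_of_pointwise {L : ℕ} [NeZero L] (G : ZMod L → ℝ) {X B : ℝ} {R : ℕ} (hX : 0 ≤ X)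
    (hB : ∀ r, |G r| ≤ B) (hgood : ∀ r : ZMod L, R ≤ r.val → r.val + R ≤ L → X ≤ G r) :
    ((L : ℝ) - 2 * R) * X - 2 * R * B ≤ ∑ r : ZMod L, G r := by
  classical
  let good : ZMod L → Prop := fun r => R ≤ r.val ∧ r.val + R ≤ L
  have hB0 : 0 ≤ B := (abs_nonneg _).trans (hB 0)
  have hcard_bad : ((Finset.univ.filter fun r => ¬ good r).card : ℝ) ≤ 2 * R := by
    have hle : (Finset.univ.filter fun r => ¬ good r).card ≤
        (Finset.range R ∪ Finset.Ioo (L - R) L).card := by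
      refine Finset.card_le_card_of_injOn ZMod.val (fun r hr => ?_) ?_
      · simp only [Finset.coe_filter, Finset.mem_univ, true_and, Set.mem_setOf_eq, good,
          not_and_or, not_le] at hr
        simp only [Finset.coe_union, Finset.coe_range, Finset.coe_Ioo, Set.mem_union,
          Set.mem_Iio, Set.mem_Ioo]
        by_cases hlt : r.val < R
        · exact Or.inl hlt
        · have hr' : L < r.val + R := by
            rcases hr with hr | hr
            · exact absurd hr hlt
            · exact hr
          exact Or.inr ⟨by omega, ZMod.val_lt r⟩
      · exact (ZMod.val_injective L).injOn
    have hle2 : (Finset.range R ∪ Finset.Ioo (L - R) L).card ≤ 2 * R := by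
      refine (Finset.card_union_le _ _).trans ?_
      rw [Finset.card_range, Nat.card_Ioo]
      omega
    exact_mod_cast hle.trans hle2
  have hcard_sum : ((Finset.univ.filter good).card : ℝ) +
      ((Finset.univ.filter fun r => ¬ good r).card : ℝ) = L := by
    have h := Finset.card_filter_add_card_filter_not (s := (Finset.univ : Finset (ZMod L))) good
    rw [Finset.card_univ, ZMod.card] at h
    exact_mod_cast h
  rw [← Finset.sum_filter_add_sum_filter_not Finset.univ good G]
  have hg : ((Finset.univ.filter good).card : ℝ) * X ≤ ∑ r ∈ Finset.univ.filter good, G r := by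
    have h := Finset.card_nsmul_le_sum (Finset.univ.filter good) G X
      (fun r hr => by
        simp only [Finset.mem_filter, Finset.mem_univ, true_and, good] at hr
        exact hgood r hr.1 hr.2)
    rwa [nsmul_eq_mul] at h
  have hb : ((Finset.univ.filter fun r => ¬ good r).card : ℝ) * (-B) ≤
      ∑ r ∈ Finset.univ.filter (fun r => ¬ good r), G r := by
    have h := Finset.card_nsmul_le_sum (Finset.univ.filter fun r => ¬ good r) G (-B)
      (fun r _ => (abs_le.1 (hB r)).1)
    rwa [nsmul_eq_mul] at h
  set g : ℝ := ((Finset.univ.filter good).card : ℝ) with hg'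
  set b : ℝ := ((Finset.univ.filter fun r => ¬ good r).card : ℝ) with hb'
  have hb0 : 0 ≤ b := by positivity
  have hgL : g = L - b := by rw [← hcard_sum]; ring
  have h1 : ((L : ℝ) - 2 * R) * X ≤ g * X := by
    rw [hgL]
    apply mul_le_mul_of_nonneg_right _ hX
    linarith
  have h2 : -(2 * R * B) ≤ b * (-B) := by nlinarith
  linarith

/-- **`SubExpBridge → S₁`**: sum the pointwise exponent-free law over the `≥ L - 2R` admissible
displacements and absorb the `≤ 2R` short ones with `|G_ψ(r)| ≤ 32·L·M²`
(`abs_tubeColumnPairCorr_le`); for `L ≥ 4R + 128R/A` this leaves `‖Δψ‖² ≥ (A/2)·L²·M²`.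
So the summed cut is LOSSLESS. [folklore] -/
theorem summedSubExpBridge_of_subExpBridge (h : SubExpBridge) : SummedSubExpBridge := by
  intro U hU δ hδ d₀ k₀ M₁ L₀ hd₀ hth
  obtain ⟨A, hA, R, M₂, L₁, hsub⟩ := h U hU δ hδ d₀ k₀ M₁ L₀ hd₀ hth
  refine ⟨A / 2, by positivity, M₂, max L₁ ⌈4 * (R : ℝ) + 128 * R / A⌉₊, ?_⟩
  intro L M _ _ hLe hMe hM hML hL hexp Λ _ _ e ψ hψ hGS
  have hlaw := hsub L M hLe hMe hM hML (le_of_max_le_left hL) hexp Λ e ψ hψ hGS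
  have hLM0 : (0 : ℝ) ≤ A * (L : ℝ) * (M : ℝ) ^ 2 := by positivity
  have hsum := sum_ge_of_pointwise (fun r => tubeColumnPairCorr L M Λ e ψ r) hLM0
    (fun r => abs_tubeColumnPairCorr_le L M Λ e hψ r) hlaw
  refine le_trans ?_ hsum
  have hLbig : 4 * (R : ℝ) + 128 * R / A ≤ (L : ℝ) := by
    have := (Nat.le_ceil (4 * (R : ℝ) + 128 * R / A)).trans
      (show (⌈4 * (R : ℝ) + 128 * R / A⌉₊ : ℝ) ≤ (L : ℝ) by exact_mod_cast le_of_max_le_right hL)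
    exact this
  have hR0 : (0 : ℝ) ≤ R := Nat.cast_nonneg R
  have hM2 : (0 : ℝ) ≤ (M : ℝ) ^ 2 := sq_nonneg _
  have hL0 : (0 : ℝ) ≤ (L : ℝ) := Nat.cast_nonneg L
  -- `128 R / A ≤ L - 4R` gives `128 R ≤ A (L - 4R)`, i.e. `2R·32 ≤ A L/2 - 2 R A + …`
  have hkey : 128 * (R : ℝ) ≤ A * ((L : ℝ) - 4 * R) := by
    have h1 : 128 * (R : ℝ) / A ≤ (L : ℝ) - 4 * R := by linarith
    have h2 := (div_le_iff₀ hA).1 h1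
    linarith [h2, mul_comm ((L : ℝ) - 4 * R) A]
  -- target: A/2 · L² M² ≤ (L - 2R)·(A L M²) - 2R·(32 L M²)
  have hexpand : ((L : ℝ) - 2 * R) * (A * (L : ℝ) * (M : ℝ) ^ 2) - 2 * R * (32 * (L : ℝ) * (M : ℝ) ^ 2)
      = (A * ((L : ℝ) - 2 * R) - 64 * R) * ((L : ℝ) * (M : ℝ) ^ 2) := by ring
  rw [hexpand]
  have hLM : (0 : ℝ) ≤ (L : ℝ) * (M : ℝ) ^ 2 := by positivity
  calc A / 2 * (L : ℝ) ^ 2 * (M : ℝ) ^ 2 = (A / 2 * (L : ℝ)) * ((L : ℝ) * (M : ℝ) ^ 2) := by ring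
    _ ≤ (A * ((L : ℝ) - 2 * R) - 64 * R) * ((L : ℝ) * (M : ℝ) ^ 2) := by
        apply mul_le_mul_of_nonneg_right _ hLM
        nlinarith

/-- Hence `X → S₁`. [folklore] -/
theorem summedSubExpBridge_of_widthHaldaneBridge (h : WidthHaldaneBridge) : SummedSubExpBridge :=
  summedSubExpBridge_of_subExpBridge (subExpBridge_of_widthHaldaneBridge h)

/-- **The summed cut is lossless**: `X ⟺ S₁ ∧ S₂ ∧ ExpBridge`. [folklore] -/
theorem widthHaldaneBridge_iff_summed_pointwise_exp :
    WidthHaldaneBridge ↔ SummedSubExpBridge ∧ PointwiseFromSummed ∧ ExpBridge :=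
  ⟨fun h => ⟨summedSubExpBridge_of_widthHaldaneBridge h,
      pointwiseFromSummed_of_subExpBridge (subExpBridge_of_widthHaldaneBridge h),
      expBridge_of_widthHaldaneBridge h⟩,
    fun h => widthHaldaneBridge_of_subExp_of_exp (subExpBridge_of_summed_of_pointwise h.1 h.2.1) h.2.2⟩

/-- **TOWER / OVERLAP FORM** of the 2D core (gen-1 census F5, D3(b)): under `UniformThermo`, on the
sub-exponential tubes, every normalised sector ground state `ψ` has a unit vector `ψ'` with
`|⟨ψ', Δψ⟩| ≥ c·L·M` (the Anderson-tower matrix element of the pair field). [cite: KomaTasaki1994, §2] -/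
def OverlapSubExpBridge : Prop :=
  ∀ U : ℝ, 0 < U → ∀ δ ∈ Set.Ioo (0 : ℝ) (3 / 10), ∀ (d₀ k₀ : ℝ) (M₁ L₀ : ℕ), 0 < d₀ →
    UniformThermo U δ d₀ k₀ M₁ L₀ →
      ∃ c : ℝ, 0 < c ∧ ∃ M₂ L₁ : ℕ, ∀ (L M : ℕ) [NeZero L] [NeZero M], Even L → Even M →
        M₂ ≤ M → M ≤ L → L₁ ≤ L → (L : ℝ) ≤ Real.exp (M : ℝ) →
          ∀ (Λ : Type) [LinearOrder Λ] [Fintype Λ] (e : Λ ≃ ZMod L × ZMod M), ∀ ψ : Fock (Orb Λ),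
            star ψ ⬝ᵥ ψ = 1 → IsGroundStateInSector (tubeH0 L M Λ e U) (tubeFilling L M δ) 0 ψ →
              ∃ ψ' : Fock (Orb Λ), star ψ' ⬝ᵥ ψ' = 1 ∧
                c * (L : ℝ) * (M : ℝ) ≤
                  ‖star ψ' ⬝ᵥ ((∑ a : ZMod L, ∑ b : ZMod M, tubeDWavePair L M Λ e (e.symm (a, b))) *ᵥ ψ)‖

/-- Cauchy–Schwarz on `n → ℂ` with the `star`-dot product: `‖⟨u, v⟩‖² ≤ Re⟨u,u⟩ · Re⟨v,v⟩`.
[folklore] -/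
theorem norm_star_dotProduct_sq_le {n : Type*} [Fintype n] (u v : n → ℂ) :
    ‖star u ⬝ᵥ v‖ ^ 2 ≤ (star u ⬝ᵥ u).re * (star v ⬝ᵥ v).re := by
  rw [← norm_toLp_sq_eq_re u, ← norm_toLp_sq_eq_re v,
    Literature.MathematicalPhysics.QuantumLattice.star_dotProduct_eq_inner u v, ← mul_pow]
  gcongr
  exact norm_inner_le_norm _ _

/-- **Overlap ⇒ summed order** (`‖Δψ‖² ≥ |⟨ψ', Δψ⟩|²` for a unit `ψ'`): the tower form of the core
implies S₁ kinematically, so an "overlap cut" relocates the 2D-order core into its overlap piece.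
[folklore] -/
theorem summedSubExpBridge_of_overlap (h : OverlapSubExpBridge) : SummedSubExpBridge := by
  intro U hU δ hδ d₀ k₀ M₁ L₀ hd₀ hth
  obtain ⟨c, hc, M₂, L₁, hov⟩ := h U hU δ hδ d₀ k₀ M₁ L₀ hd₀ hth
  refine ⟨c ^ 2, by positivity, M₂, L₁, ?_⟩
  intro L M _ _ hLe hMe hM hML hL hexp Λ _ _ e ψ hψ hGS
  obtain ⟨ψ', hψ', hge⟩ := hov L M hLe hMe hM hML hL hexp Λ e ψ hψ hGS
  rw [sum_tubeColumnPairCorr_eq]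
  set v := (∑ a : ZMod L, ∑ b : ZMod M, tubeDWavePair L M Λ e (e.symm (a, b))) *ᵥ ψ with hv
  have hcs := norm_star_dotProduct_sq_le ψ' v
  rw [hψ', Complex.one_re, one_mul] at hcs
  have hc0 : 0 ≤ c * (L : ℝ) * (M : ℝ) := by positivity
  calc c ^ 2 * (L : ℝ) ^ 2 * (M : ℝ) ^ 2 = (c * (L : ℝ) * (M : ℝ)) ^ 2 := by ring
    _ ≤ ‖star ψ' ⬝ᵥ v‖ ^ 2 := pow_le_pow_left₀ hc0 hge 2
    _ ≤ (star v ⬝ᵥ v).re := hcs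

/-! ## §4 The minimal load-bearing shadow: the SUMMED DIAGONAL bridge and its re-glue -/

/-- **SDB = SUMMED DIAGONAL BRIDGE** — what `WidthHaldane.closes` ACTUALLY needs from stmt-16311:
for every `U > 0`, `δ ∈ (0, 3/10)` and data, width-uniform tube thermodynamics forces the SUMMIT'S
OWN ORDER FUNCTIONAL on the square tori, `⟨ψ, Δ_d†Δ_d ψ⟩ = Σ_r G_ψ(r) ≥ A·L⁴` for every normalised
sector ground state of the pure `L × L` Hubbard torus, `L ≥ L₁` even. Weaker than `DiagonalBridge`
(pointwise), than `SubExpBridge`, than the crux; "superfluid stiffness + pair compressibility ⇒ d-wave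
pair-field LRO in d = 2 at T = 0" — the converse-Sewell direction, open. [cite: Scalapino1995, §2 eq. (2.4)]
[cite: ScalapinoWhiteZhang1993, §II] -/
def SummedDiagonalBridge : Prop :=
  ∀ U : ℝ, 0 < U → ∀ δ ∈ Set.Ioo (0 : ℝ) (3 / 10), ∀ (d₀ k₀ : ℝ) (M₁ L₀ : ℕ), 0 < d₀ →
    UniformThermo U δ d₀ k₀ M₁ L₀ →
      ∃ A : ℝ, 0 < A ∧ ∃ L₁ : ℕ, ∀ (L : ℕ) [NeZero L], Even L → L₁ ≤ L → SummedOrderLM U δ L L A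

/-- `S₁ → SDB` (the diagonal `M = L ≤ e^L`). [folklore] -/
theorem summedDiagonalBridge_of_summedSubExpBridge (h : SummedSubExpBridge) :
    SummedDiagonalBridge := by
  intro U hU δ hδ d₀ k₀ M₁ L₀ hd₀ hth
  obtain ⟨A, hA, M₂, L₁, hsum⟩ := h U hU δ hδ d₀ k₀ M₁ L₀ hd₀ hth
  refine ⟨A, hA, max M₂ L₁, ?_⟩
  intro L _ hLe hL
  have hexp : (L : ℝ) ≤ Real.exp (L : ℝ) := by
    have := Real.add_one_le_exp (L : ℝ)
    linarith
  have h4 := hsum L L hLe hLe (le_of_max_le_left hL) le_rfl (le_of_max_le_right hL) hexp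
  exact h4

/-- Hence `X → SDB`. [folklore] -/
theorem summedDiagonalBridge_of_widthHaldaneBridge (h : WidthHaldaneBridge) : SummedDiagonalBridge :=
  summedDiagonalBridge_of_summedSubExpBridge (summedSubExpBridge_of_widthHaldaneBridge h)

/-- And `DiagonalBridge → SDB` (sum the pointwise diagonal law; same counting). [folklore] -/
theorem summedDiagonalBridge_of_diagonalBridge (h : DiagonalBridge) : SummedDiagonalBridge := by
  intro U hU δ hδ d₀ k₀ M₁ L₀ hd₀ hth
  obtain ⟨A, hA, R, L₁, hdiag⟩ := h U hU δ hδ d₀ k₀ M₁ L₀ hd₀ hth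
  refine ⟨A / 2, by positivity, max L₁ ⌈4 * (R : ℝ) + 128 * R / A⌉₊, ?_⟩
  intro L _ hLe hL Λ _ _ e ψ hψ hGS
  have hlaw := hdiag L hLe (le_of_max_le_left hL) Λ e ψ hψ hGS
  have hLM0 : (0 : ℝ) ≤ A * (L : ℝ) * (L : ℝ) ^ 2 := by positivity
  have hsum := sum_ge_of_pointwise (fun r => tubeColumnPairCorr L L Λ e ψ r) hLM0
    (fun r => abs_tubeColumnPairCorr_le L L Λ e hψ r) hlaw
  refine le_trans ?_ hsum
  have hLbig : 4 * (R : ℝ) + 128 * R / A ≤ (L : ℝ) :=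
    (Nat.le_ceil (4 * (R : ℝ) + 128 * R / A)).trans
      (show (⌈4 * (R : ℝ) + 128 * R / A⌉₊ : ℝ) ≤ (L : ℝ) by exact_mod_cast le_of_max_le_right hL)
  have hR0 : (0 : ℝ) ≤ R := Nat.cast_nonneg R
  have hkey : 128 * (R : ℝ) ≤ A * ((L : ℝ) - 4 * R) := by
    have h1 : 128 * (R : ℝ) / A ≤ (L : ℝ) - 4 * R := by linarith
    have h2 := (div_le_iff₀ hA).1 h1
    linarith [h2, mul_comm ((L : ℝ) - 4 * R) A]
  have hexpand : ((L : ℝ) - 2 * R) * (A * (L : ℝ) * (L : ℝ) ^ 2) - 2 * R * (32 * (L : ℝ) * (L : ℝ) ^ 2)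
      = (A * ((L : ℝ) - 2 * R) - 64 * R) * ((L : ℝ) * (L : ℝ) ^ 2) := by ring
  rw [hexpand]
  have hLM : (0 : ℝ) ≤ (L : ℝ) * (L : ℝ) ^ 2 := by positivity
  calc A / 2 * (L : ℝ) ^ 2 * (L : ℝ) ^ 2 = (A / 2 * (L : ℝ)) * ((L : ℝ) * (L : ℝ) ^ 2) := by ring
    _ ≤ (A * ((L : ℝ) - 2 * R) - 64 * R) * ((L : ℝ) * (L : ℝ) ^ 2) := by
        apply mul_le_mul_of_nonneg_right _ hLM
        nlinarith

/-- **RE-GLUE CERTIFICATE ON THE SUMMED DIAGONAL (census R1′).** `SummedDiagonalBridge` and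
`WidthUniformThermodynamics` already give the summit: `WidthHaldane.closes` with its step (1) (rpow
bookkeeping) and the column-law/Cauchy–Schwarz half of step (3) removed — the summed torus functional
is fed to `hasLongRangeOrder_even_of_le` directly after the reindexing `sum_torusSite_two_reindex`
and the identification of the tube's column pair field with `localPair dWaveFormFactor` (verbatim
from `closes`). [folklore] -/
theorem closes_summed (h1 : SummedDiagonalBridge) (h2 : WidthUniformThermodynamics) :
    _root_.HubbardSuperconductivity := by
  obtain ⟨U, hU, δ, hδ, d₀, hd₀, k₀, M₁, L₀, hth⟩ := widthUniformThermodynamics_iff.1 h2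
  obtain ⟨A, hA, L₁, hlaw⟩ := h1 U hU δ hδ d₀ k₀ M₁ L₀ hd₀ hth
  refine ⟨U, hU, δ, ⟨hδ.1, hδ.2.trans (by norm_num)⟩, fun N ψ hE => ?_⟩
  refine Literature.MathematicalPhysics.QuantumLattice.hasLongRangeOrder_even_of_le
    Literature.MathematicalPhysics.QuantumLattice.dWaveFormFactor ψ (fun n hn => (hE (n + 1) hn).2.1)
    hA L₁ ?_
  intro n hev hK
  obtain ⟨hN, hn1, hGS⟩ := hE (n + 1) hev
  rw [hN] at hGS
  simp only [Literature.MathematicalPhysics.QuantumLattice.pairFieldCorr_succ]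
  rw [Literature.MathematicalPhysics.QuantumLattice.sum_torusSite_two_reindex]
  -- the diagonal labelling of `FermionTorus 2 (n+1)` (verbatim from `WidthHaldane.closes`)
  obtain ⟨e₀, he₀, he₀s⟩ : ∃ e : Literature.MathematicalPhysics.QuantumLattice.FermionTorus 2 (n + 1) ≃ ZMod (n + 1) × ZMod (n + 1),
      (∀ x, e x = (Literature.MathematicalPhysics.QuantumLattice.FermionTorus.toTorusSite x 0, Literature.MathematicalPhysics.QuantumLattice.FermionTorus.toTorusSite x 1)) ∧
        ∀ p : ZMod (n + 1) × ZMod (n + 1), e.symm p = Literature.MathematicalPhysics.QuantumLattice.FermionTorus.ofTorusSite ![p.1, p.2] :=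
    ⟨Literature.MathematicalPhysics.QuantumLattice.FermionTorus.equivTorusSite.trans (finTwoArrowEquiv _), fun x => rfl, fun p => rfl⟩
  have hinj : ∀ u v : Literature.MathematicalPhysics.QuantumLattice.FermionTorus 2 (n + 1),
      Literature.MathematicalPhysics.QuantumLattice.FermionTorus.toTorusSite u = Literature.MathematicalPhysics.QuantumLattice.FermionTorus.toTorusSite v ↔ u = v := fun u v =>
    (Literature.MathematicalPhysics.QuantumLattice.FermionTorus.equivTorusSite (d := 2) (L := n + 1)).injective.eq_iff
  have hsymm : ∀ (v : Literature.MathematicalPhysics.QuantumLattice.FermionTorus 2 (n + 1)) (p : ZMod (n + 1) × ZMod (n + 1)),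
      v = e₀.symm p ↔ Literature.MathematicalPhysics.QuantumLattice.FermionTorus.toTorusSite v = ![p.1, p.2] := by
    intro v p
    rw [Equiv.eq_symm_apply, he₀, Prod.ext_iff, funext_iff, Fin.forall_fin_two]
    simp
  have hS0 : ∀ t : Fin 2 → ZMod (n + 1), t + Pi.single 0 1 = ![t 0 + 1, t 1] := fun t => by
    funext i; fin_cases i <;> simp
  have hS1 : ∀ t : Fin 2 → ZMod (n + 1), t + Pi.single 1 1 = ![t 0, t 1 + 1] := fun t => by
    funext i; fin_cases i <;> simp
  have hp1 : ∀ t : Fin 2 → ZMod (n + 1), t + Literature.Probability.LatticeModels.Torus.proj (n + 1) (Pi.single 0 1) = ![t 0 + 1, t 1] :=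
    fun t => by funext i; fin_cases i <;> simp
  have hp2 : ∀ t : Fin 2 → ZMod (n + 1), t + Literature.Probability.LatticeModels.Torus.proj (n + 1) (-Pi.single 0 1) = ![t 0 - 1, t 1] :=
    fun t => by funext i; fin_cases i <;> simp [sub_eq_add_neg]
  have hp3 : ∀ t : Fin 2 → ZMod (n + 1), t + Literature.Probability.LatticeModels.Torus.proj (n + 1) (Pi.single 1 1) = ![t 0, t 1 + 1] :=
    fun t => by funext i; fin_cases i <;> simp
  have hp4 : ∀ t : Fin 2 → ZMod (n + 1), t + Literature.Probability.LatticeModels.Torus.proj (n + 1) (-Pi.single 1 1) = ![t 0, t 1 - 1] :=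
    fun t => by funext i; fin_cases i <;> simp [sub_eq_add_neg]
  have hHc : ∀ (G₁ G₂ : SimpleGraph (Literature.MathematicalPhysics.QuantumLattice.FermionTorus 2 (n + 1))) (i₁ : DecidableRel G₁.Adj)
      (i₂ : DecidableRel G₂.Adj), (∀ x y, G₁.Adj x y ↔ G₂.Adj x y) →
      @Literature.MathematicalPhysics.QuantumLattice.hamiltonian _ _ _ G₁ i₁ 1 U = @Literature.MathematicalPhysics.QuantumLattice.hamiltonian _ _ _ G₂ i₂ 1 U := by
    intro G₁ G₂ i₁ i₂ h
    have hG : G₁ = G₂ := by ext x y; exact h x y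
    subst hG
    congr
  have hd1 : Literature.MathematicalPhysics.QuantumLattice.dWaveFormFactor (Pi.single 0 1) = 1 := if_pos (Or.inl rfl)
  have hd2 : Literature.MathematicalPhysics.QuantumLattice.dWaveFormFactor (-Pi.single 0 1) = 1 := if_pos (Or.inr rfl)
  have hd3 : Literature.MathematicalPhysics.QuantumLattice.dWaveFormFactor (Pi.single 1 1) = -1 := by
    have hne1 : (Pi.single 1 1 : Fin 2 → ℤ) ≠ Pi.single 0 1 := fun h => by simpa using congrFun h 0
    have hne2 : (Pi.single 1 1 : Fin 2 → ℤ) ≠ -Pi.single 0 1 := fun h => by simpa using congrFun h 0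
    rw [Literature.MathematicalPhysics.QuantumLattice.dWaveFormFactor, if_neg (not_or.2 ⟨hne1, hne2⟩), if_pos (Or.inl rfl)]
  have hd4 : Literature.MathematicalPhysics.QuantumLattice.dWaveFormFactor (-Pi.single 1 1) = -1 := by
    have hne3 : (-Pi.single 1 1 : Fin 2 → ℤ) ≠ Pi.single 0 1 := fun h => by simpa using congrFun h 0
    have hne4 : (-Pi.single 1 1 : Fin 2 → ℤ) ≠ -Pi.single 0 1 := fun h => by simpa using congrFun h 1
    rw [Literature.MathematicalPhysics.QuantumLattice.dWaveFormFactor, if_neg (not_or.2 ⟨hne3, hne4⟩), if_pos (Or.inr rfl)]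
  have hsum : ∀ {β : Type} [AddCommMonoid β] (f : (Fin 2 → ℤ) → β), ∑ e ∈ Literature.MathematicalPhysics.QuantumLattice.unitSteps, f e =
      f (Pi.single 0 1) + f (-Pi.single 0 1) + f (Pi.single 1 1) + f (-Pi.single 1 1) := by
    intro β _ f
    have h1 : (Pi.single 0 1 : Fin 2 → ℤ) ∉
        ({-Pi.single 0 1, Pi.single 1 1, -Pi.single 1 1} : Finset (Fin 2 → ℤ)) := by
      simp only [Finset.mem_insert, Finset.mem_singleton]; decide
    have h2 : (-Pi.single 0 1 : Fin 2 → ℤ) ∉ ({Pi.single 1 1, -Pi.single 1 1} : Finset (Fin 2 → ℤ)) := by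
      simp only [Finset.mem_insert, Finset.mem_singleton]; decide
    have h3 : (Pi.single 1 1 : Fin 2 → ℤ) ∉ ({-Pi.single 1 1} : Finset (Fin 2 → ℤ)) := by
      simp only [Finset.mem_singleton]; decide
    rw [Literature.MathematicalPhysics.QuantumLattice.unitSteps, Finset.sum_insert h1, Finset.sum_insert h2, Finset.sum_insert h3,
      Finset.sum_singleton]
    abel
  -- the summed diagonal law on the carrier `FermionTorus 2 (n+1)`
  have key := hlaw (n + 1) hev hK (Literature.MathematicalPhysics.QuantumLattice.FermionTorus 2 (n + 1)) e₀ (ψ (n + 1)) hn1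
  convert key ?gs using 1
  case gs =>
    dsimp only [tubeH0, tubeFilling]
    convert hGS using 2
    · rw [Literature.MathematicalPhysics.QuantumLattice.hubbardTorus]
      refine hHc _ _ _ _ fun x y => ?_
      simp only [SimpleGraph.fromRel_adj, Literature.MathematicalPhysics.QuantumLattice.fermionTorusGraph_adj, Literature.Probability.LatticeModels.torusGraph_adj_iff,
        Fin.exists_fin_two, hsymm, he₀, hS0, hS1, ne_eq, hinj]
    · simp only [sq]
  · push_cast; ring
  · refine Finset.sum_congr rfl fun r _ => ?_
    simp only [tubeColumnPairCorr, tubeDWavePair, Fin.sum_univ_four, Matrix.cons_val_zero, Matrix.cons_val_one, Matrix.cons_val,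
      Equiv.apply_symm_apply]
    simp only [he₀s]
    refine Finset.sum_congr rfl fun a _ => ?_
    rw [Matrix.conjTranspose_sum, Finset.sum_mul]
    simp only [Finset.mul_sum, Literature.MathematicalPhysics.QuantumLattice.expect_sum, Complex.re_sum]
    refine Finset.sum_congr rfl fun b _ => Finset.sum_congr rfl fun b' _ => ?_
    simp only [Literature.MathematicalPhysics.QuantumLattice.localPair_dWave_eq_localPairOn_unitSteps, Literature.MathematicalPhysics.QuantumLattice.localPairOn_eq_sum_singletBond, hsum,
      Literature.MathematicalPhysics.QuantumLattice.singletBond, hd1, hd2, hd3, hd4, hp1, hp2, hp3, hp4, Matrix.cons_val_zero,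
      Matrix.cons_val_one]


/-! ## §5 Drop-in raw signature for the tenure planner (census R1′) -/

/-- **`SummedDiagonalBridge` in the route's own `let`-vocabulary** (character-for-character the
`let`-prefix of item `WidthHaldaneBridge`, so that it elaborates in the route file, which cannot import
`Theorems/WidthHaldaneDefs`): the signature to file with
`ledger workitem add --kind statement --route route-HubbardSuperconductivity-WidthHaldane --name SummedDiagonalBridge --signature …`
if the tenure planner adopts R1′ (re-glue `closes` on the summed diagonal; text in `SummedDiagonalBridgeRaw.sig`).
`summedDiagonalBridgeRaw_iff` certifies it IS `SummedDiagonalBridge` (`Iff.rfl`). [cite: Scalapino1995, §2 eq. (2.4)]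
[cite: ScalapinoWhiteZhang1993, §II] -/
def SummedDiagonalBridgeRaw : Prop :=
  open Matrix Literature.MathematicalPhysics.QuantumLattice in let H0 : ∀ (L M : ℕ) (Λ : Type) [LinearOrder Λ] [Fintype Λ], (Λ ≃ ZMod L × ZMod M) → ℝ → Matrix (Finset (Orb Λ)) (Finset (Orb Λ)) ℂ := fun _ _ Λ _ _ e U => hamiltonian (SimpleGraph.fromRel fun x y : Λ => y = e.symm ((e x).1 + 1, (e x).2) ∨ y = e.symm ((e x).1, (e x).2 + 1)) 1 U; let Tw : ∀ (L M : ℕ) [NeZero L] [NeZero M] (Λ : Type) [LinearOrder Λ] [Fintype Λ], (Λ ≃ ZMod L × ZMod M) → ℝ → Matrix (Finset (Orb Λ)) (Finset (Orb Λ)) ℂ := fun _ M _ _ _ _ _ e θ => ∑ b : ZMod M, ∑ σ : Fin 2, ((1 - Complex.exp (Complex.I * θ)) • (creation (orb (e.symm (0, b)) σ) * annihilation (orb (e.symm (-1, b)) σ)) + (1 - Complex.exp (-(Complex.I * θ))) • (creation (orb (e.symm (-1, b)) σ) * annihilation (orb (e.symm (0, b)) σ))); let E : ∀ (L M : ℕ)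 [NeZero L] [NeZero M] (Λ : Type) [LinearOrder Λ] [Fintype Λ], (Λ ≃ ZMod L × ZMod M) → ℝ → ℝ → ℕ → ℝ := fun L M _ _ Λ _ _ e U θ N => (H0 L M Λ e U + Tw L M Λ e θ).minEnergyOn (szSector N 0); let Np : ℕ → ℕ → ℝ → ℕ := fun L M δ => 2 * ⌊(1 - δ) * ((L : ℝ) * (M : ℝ)) / 2⌋₊; let stiff : ∀ (L M : ℕ) [NeZero L] [NeZero M] (Λ : Type) [LinearOrder Λ] [Fintype Λ], (Λ ≃ ZMod L × ZMod M) → ℝ → ℝ → ℝ := fun L M _ _ Λ _ _ e U δ => 2 * (L : ℝ) * (E L M Λ e U (Real.pi / 3) (Np L M δ) - E L M Λ e U 0 (Np L M δ)) / ((Real.pi / 3) ^ 2 * (M : ℝ)); let icomp : ∀ (L M : ℕ) [NeZero L] [NeZero M] (Λ : Type) [LinearOrder Λ] [Fintype Λ], (Λ ≃ ZMod L × ZMod M) → ℝ → ℝ → ℝ := fun L M _ _ Λ _ _ e U δ => (L : ℝ) * (M : ℝ) * (E L M Λ e U 0 (Np L M δ + 2) + E L M Λ e U 0 (Np L M δ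 - 2) - 2 * E L M Λ e U 0 (Np L M δ)) / 4; let P : ∀ (L M : ℕ) (Λ : Type) [LinearOrder Λ] [Fintype Λ], (Λ ≃ ZMod L × ZMod M) → Λ → Matrix (Finset (Orb Λ)) (Finset (Orb Λ)) ℂ := fun _ _ Λ _ _ e x => ∑ j : Fin 4, (((![1, 1, -1, -1] : Fin 4 → ℝ) j / Real.sqrt 2 : ℝ) : ℂ) • (annihilation (orb x 0) * annihilation (orb ((![e.symm ((e x).1 + 1, (e x).2), e.symm ((e x).1 - 1, (e x).2), e.symm ((e x).1, (e x).2 + 1), e.symm ((e x).1, (e x).2 - 1)] : Fin 4 → Λ) j) 1) - annihilation (orb x 1) * annihilation (orb ((![e.symm ((e x).1 + 1, (e x).2), e.symm ((e x).1 - 1, (e x).2), e.symm ((e x).1, (e x).2 + 1), e.symm ((e x).1, (e x).2 - 1)] : Fin 4 → Λ) j) 0)); let G : ∀ (L M : ℕ) [NeZero L] [NeZero M] (Λ : Type) [LinearOrder Λ] [Fintype Λ], (Λ ≃ ZMod L × ZMod M) → Fock (Orb Λ) → ZMod L → ℝ := fun L M _ _ Λ _ _ e ψ r => ∑ a : ZMod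 L, (expect ((∑ b : ZMod M, P L M Λ e (e.symm (a, b)))ᴴ * (∑ b : ZMod M, P L M Λ e (e.symm (a + r, b)))) ψ).re; ∀ U : ℝ, 0 < U → ∀ δ ∈ Set.Ioo (0 : ℝ) (3 / 10), ∀ (d₀ k₀ : ℝ) (M₁ L₀ : ℕ), 0 < d₀ → (∀ (L M : ℕ) [NeZero L] [NeZero M], Even L → Even M → M₁ ≤ M → M ≤ L → L₀ ≤ L → ∀ (Λ : Type) [LinearOrder Λ] [Fintype Λ] (e : Λ ≃ ZMod L × ZMod M), d₀ ≤ stiff L M Λ e U δ ∧ 0 < icomp L M Λ e U δ ∧ icomp L M Λ e U δ ≤ k₀) → ∃ A : ℝ, 0 < A ∧ ∃ L₁ : ℕ, ∀ (L : ℕ) [NeZero L], Even L → L₁ ≤ L → ∀ (Λ : Type) [LinearOrder Λ] [Fintype Λ] (e : Λ ≃ ZMod L × ZMod L), ∀ ψ : Fock (Orb Λ), star ψ ⬝ᵥ ψ = 1 → IsGroundStateInSector (H0 L L Λ e U) (Np L L δ) 0 ψ → A * (L : ℝ) ^ 2 * (L : ℝ) ^ 2 ≤ ∑ r : ZMod L,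 G L L Λ e ψ r

/-- Faithfulness of the drop-in signature (`δζ`-convertibility). [folklore] -/
theorem summedDiagonalBridgeRaw_iff : SummedDiagonalBridgeRaw ↔ SummedDiagonalBridge :=
  Iff.rfl

end Summit.HubbardSuperconductivity.HubbardSuperconductivity.Cruxes.WidthHaldaneBridge.StrategistR1

end
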